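import Summits.AtomisticToContinuum.HydrodynamicLimit.Theorems.CollisionActivityTails.Negative.Kinematics
import Summits.AtomisticToContinuum.HydrodynamicLimit.Theorems.CollisionActivityTails.Negative.EquilibriumReduction

/-!
# Negative knowledge for the crux `CollisionActivityTails` — the weaker RUNGS (fraction, UI)

From the standing disprover's `Cruxes/CollisionActivityTails/Disproof.lean` §7f (gen 2, cycle 2;
crux stmt-AtomisticToContinuum-13734).  The crux decl is
`Summit.AtomisticToContinuum.HydrodynamicLimit.Theses.OneFlightGossipEngine.CollisionActivityTails`
(route OneFlightGossipEngine, item #6); route TwoClocks carried the byte-identical copy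
`Theses.TwoClocks.CollisionActivityTails` until its rev 10 (2026-08-16) restated it as
`TransferActivityTails` (stmt-AtomisticToContinuum-16624), so this file now reads the crux from the
OneFlightGossipEngine module (statement of stmt-13734 unchanged).
Nothing here asserts the crux: every theorem is an implication FROM the crux (by name) to a
strictly weaker statement in the crux's own frame — i.e. a typed REFUTATION TARGET (refute the
rung ⇒ the crux is false):

* `CollisionActivityFraction` — the crux-shaped FRACTION statement: the expected fraction of
  spheres whose window activity exceeds `V ≥ V₀` vanishes as `τ → ∞` after `N → ∞`, uniformly in
  `s ≤ t`, pre-shock (no activity weighting; the cleanest "no hyperactive fraction");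
  `collisionActivityFraction_of_crux` (Chebyshev at the threshold,
  `V · 𝟙{V < y} ≤ 𝟙{V < y} y`, integrated as lower integrals — no measurability).
* `CollisionActivityUI` — the UI-shaped statement (threshold after `ε`);
  `collisionActivityUI_of_crux`.
* `EquilibriumActivityFraction` — the equilibrium fraction rung (canonical Gibbs law, constant
  profiles, window `(0, w]`): the window activity of a tagged sphere exceeds `V` with vanishing
  PROBABILITY; `equilibriumActivityFraction_of_crux` composes the landed unconditional equilibrium
  reduction (`Negative/EquilibriumReduction.lean`) with Chebyshev, and
  `not_collisionActivityTails_of_not_equilibriumActivityFraction` is the contrapositive — the barest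
  tagged-particle law-of-large-numbers statement the crux contains.

With the UI ⊓ fraction EQUIVALENCE of `Negative/ShapeSeparation.lean` (abstract law functionals),
this records that for the crux functional the cycle-2 split of line `SketchK1` is a repackaging
(`crux ⇒ UI ∧ fraction` here; `UI ∧ fraction ⇒ tails` is the line's composition, not restated).

2026-08-17 repair (route TwoClocks rev 10 removed its copy of the crux decl; importer rebuild after the
sibling repairs `Negative/Kinematics.lean`, `Negative/EquilibriumReduction.lean`): the four statements
naming the crux are restated verbatim against the OneFlightGossipEngine decl under the new names
`fraction_of_crux`, `ui_of_crux`, `equilibriumFraction_of_crux`, `not_crux_of_not_equilibriumFraction`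
(same proofs, reading the crux through `collisionActivityTails_iff_activityTail` and the equilibrium
reduction through `CollisionActivityTailsEquilibrium.equilibrium_of_crux`, the repaired siblings' live
names); the landed names `collisionActivityFraction_of_crux`, `collisionActivityUI_of_crux`,
`equilibriumActivityFraction_of_crux`, `not_collisionActivityTails_of_not_equilibriumActivityFraction` are
kept as deprecated aliases of them (append-only: deprecate, don't mutate).  No other declaration changed.
-/

noncomputable section

open MeasureTheory Filter Set Topology
open scoped ENNReal

namespace Summit.AtomisticToContinuum.HydrodynamicLimit.Theorems

namespace CollisionActivityTailsFraction

open Literature.MathematicalPhysics.KineticTheory Literature.Analysis.FluidPDE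
open CollisionActivityTailsNegative

/-- The scalar FRACTION functional `y ↦ 𝟙{V < y}`. -/
def fracFn (V y : ℝ) : ℝ := Set.indicator {y : ℝ | V < y} (fun _ => (1 : ℝ)) y

/-- The empirical hyperactive fraction `(N+1)⁻¹ #{i : V < aᵢ}` of an activity vector. -/
def activityFrac (N : ℕ) (V : ℝ) (a : Fin (N + 1) → ℝ) : ℝ :=
  ((N : ℝ) + 1)⁻¹ * ∑ i : Fin (N + 1), fracFn V (a i)

/-- `V 𝟙{V < y} ≤ 𝟙{V < y} y`. -/
theorem mul_fracFn_le_tailFn (V y : ℝ) : V * fracFn V y ≤ tailFn V y := by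
  by_cases h : V < y
  · rw [fracFn, Set.indicator_of_mem (show y ∈ {y : ℝ | V < y} from h), mul_one, tailFn_of_lt h]
    exact h.le
  · rw [fracFn, Set.indicator_of_notMem (show y ∉ {y : ℝ | V < y} from h), mul_zero,
      tailFn_of_le (not_lt.1 h)]

/-- **Chebyshev at the threshold, empirical form**: `V · (fraction above V) ≤ (tail above V)`. -/
theorem mul_activityFrac_le_activityTail (N : ℕ) (V : ℝ) (a : Fin (N + 1) → ℝ) :
    V * activityFrac N V a ≤ activityTail N V a := by
  unfold activityFrac activityTail
  rw [mul_left_comm, Finset.mul_sum]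
  exact mul_le_mul_of_nonneg_left (Finset.sum_le_sum fun i _ => mul_fracFn_le_tailFn V (a i))
    (by positivity)

/-- **Chebyshev at the threshold, integrated**: for `V ≥ 0` and ANY random activity vector,
`V · E[fraction above V] ≤ E[tail above V]` (lower integrals; no measurability needed). -/
theorem ofReal_mul_lintegral_activityFrac_le {Ω : Type*} [MeasurableSpace Ω] (μ : Measure Ω)
    (N : ℕ) {V : ℝ} (hV : 0 ≤ V) (a : Ω → Fin (N + 1) → ℝ) :
    ENNReal.ofReal V * ∫⁻ z, ENNReal.ofReal (activityFrac N V (a z)) ∂μ ≤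
      ∫⁻ z, ENNReal.ofReal (activityTail N V (a z)) ∂μ := by
  rw [← lintegral_const_mul' _ _ ENNReal.ofReal_ne_top]
  refine lintegral_mono fun z => ?_
  rw [← ENNReal.ofReal_mul hV]
  exact ENNReal.ofReal_le_ofReal (mul_activityFrac_le_activityTail N V (a z))

/-- **The FRACTION rung of the crux** (crux frame verbatim, `activityTail ↦ activityFrac`): the
expected FRACTION of spheres whose window activity exceeds `V ≥ V₀` vanishes as `τ → ∞` after
`N → ∞`, uniformly in `s ≤ t`, pre-shock. -/
def CollisionActivityFraction : Prop :=
  ∀ (a₀ θ₀ : T3 → ℝ) (u₀ : T3 → V3), Continuous a₀ → Continuous θ₀ → Continuous u₀ →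
    (∀ x, 0 < a₀ x) → (∀ x, 0 < θ₀ x) → ∃ σ₀ : ℝ, 0 < σ₀ ∧ ∀ σ : ℝ, 0 < σ → σ < σ₀ →
    ∀ (T : ℝ) (ρ θ : ℝ → T3 → ℝ) (u : ℝ → T3 → V3), IsHardSphereEulerSolution σ T ρ u θ →
    ∀ Φ : (N : ℕ) → Flow σ N,
    TendstoHydroFieldsAt (fun N => localGibbsLaw σ a₀ u₀ θ₀ N (Φ N)) Φ ρ u θ 0 →
    ∀ t ∈ Set.Ico 0 T, ∃ V₀ : ℝ, 0 < V₀ ∧ ∀ V : ℝ, V₀ ≤ V → ∀ ε : ℝ, 0 < ε →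
    ∃ τ₀ : ℝ, 0 < τ₀ ∧ ∀ τ : ℝ, τ₀ ≤ τ → ∃ N₀ : ℕ, ∀ N : ℕ, N₀ ≤ N → ∀ s ∈ Set.Icc 0 t,
      ∫⁻ z, ENNReal.ofReal (activityFrac N V
          (fun i => activity (Φ N) τ (Set.Ioc s (s + window τ N)) i z))
        ∂(localGibbsLaw σ a₀ u₀ θ₀ N (Φ N)) ≤ ENNReal.ofReal ε

/-- **The UI rung of the crux** (crux frame, UI shape: the threshold may depend on `ε`). -/
def CollisionActivityUI : Prop :=
  ∀ (a₀ θ₀ : T3 → ℝ) (u₀ : T3 → V3), Continuous a₀ → Continuous θ₀ → Continuous u₀ →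
    (∀ x, 0 < a₀ x) → (∀ x, 0 < θ₀ x) → ∃ σ₀ : ℝ, 0 < σ₀ ∧ ∀ σ : ℝ, 0 < σ → σ < σ₀ →
    ∀ (T : ℝ) (ρ θ : ℝ → T3 → ℝ) (u : ℝ → T3 → V3), IsHardSphereEulerSolution σ T ρ u θ →
    ∀ Φ : (N : ℕ) → Flow σ N,
    TendstoHydroFieldsAt (fun N => localGibbsLaw σ a₀ u₀ θ₀ N (Φ N)) Φ ρ u θ 0 →
    ∀ t ∈ Set.Ico 0 T, ∀ ε : ℝ, 0 < ε → ∃ K : ℝ,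
    ∃ τ₀ : ℝ, 0 < τ₀ ∧ ∀ τ : ℝ, τ₀ ≤ τ → ∃ N₀ : ℕ, ∀ N : ℕ, N₀ ≤ N → ∀ s ∈ Set.Icc 0 t,
      ∫⁻ z, ENNReal.ofReal (activityTail N K
          (fun i => activity (Φ N) τ (Set.Ioc s (s + window τ N)) i z))
        ∂(localGibbsLaw σ a₀ u₀ θ₀ N (Φ N)) ≤ ENNReal.ofReal ε

/-- **Crux ⇒ fraction rung** (Chebyshev at the threshold).  Contrapositive: a non-vanishing
EXPECTED FRACTION of hyperactive spheres (any level `V`, in the iterated limit) refutes the crux. -/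
theorem fraction_of_crux
    (h : Summit.AtomisticToContinuum.HydrodynamicLimit.Theses.OneFlightGossipEngine.CollisionActivityTails) :
    CollisionActivityFraction := by
  rw [collisionActivityTails_iff_activityTail] at h
  intro a₀ θ₀ u₀ ha hθ hu ha0 hθ0
  obtain ⟨σ₀, hσ₀, h⟩ := h a₀ θ₀ u₀ ha hθ hu ha0 hθ0
  refine ⟨σ₀, hσ₀, fun σ hσ hσσ₀ T ρ θ u hsol Φ hLLN t ht => ?_⟩
  obtain ⟨V₀, hV₀, h⟩ := h σ hσ hσσ₀ T ρ θ u hsol Φ hLLN t ht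
  refine ⟨V₀, hV₀, fun V hV ε hε => ?_⟩
  have hVpos : 0 < V := hV₀.trans_le hV
  obtain ⟨τ₀, hτ₀, h⟩ := h V hV (V * ε) (mul_pos hVpos hε)
  refine ⟨τ₀, hτ₀, fun τ hτ => ?_⟩
  obtain ⟨N₀, h⟩ := h τ hτ
  refine ⟨N₀, fun N hN s hs => ?_⟩
  have key := (ofReal_mul_lintegral_activityFrac_le (localGibbsLaw σ a₀ u₀ θ₀ N (Φ N)) N hVpos.le
    fun z i => activity (Φ N) τ (Set.Ioc s (s + window τ N)) i z).trans (h N hN s hs)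
  rw [ENNReal.ofReal_mul hVpos.le] at key
  exact (ENNReal.mul_le_mul_iff_right (ENNReal.ofReal_pos.2 hVpos).ne' ENNReal.ofReal_ne_top).1 key

/-- Former name of `fraction_of_crux`, stated through the TwoClocks copy of the crux
(`Theses.TwoClocks.CollisionActivityTails`, removed by route TwoClocks rev 10 on 2026-08-16); the
statement of the crux (stmt-AtomisticToContinuum-13734) is unchanged. -/
@[deprecated fraction_of_crux (since := "2026-08-17")]
alias collisionActivityFraction_of_crux := fraction_of_crux

/-- **Crux ⇒ UI rung** (take `K := V₀`). -/
theorem ui_of_crux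
    (h : Summit.AtomisticToContinuum.HydrodynamicLimit.Theses.OneFlightGossipEngine.CollisionActivityTails) :
    CollisionActivityUI := by
  rw [collisionActivityTails_iff_activityTail] at h
  intro a₀ θ₀ u₀ ha hθ hu ha0 hθ0
  obtain ⟨σ₀, hσ₀, h⟩ := h a₀ θ₀ u₀ ha hθ hu ha0 hθ0
  refine ⟨σ₀, hσ₀, fun σ hσ hσσ₀ T ρ θ u hsol Φ hLLN t ht ε hε => ?_⟩
  obtain ⟨V₀, -, h⟩ := h σ hσ hσσ₀ T ρ θ u hsol Φ hLLN t ht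
  exact ⟨V₀, h V₀ le_rfl ε hε⟩

/-- Former name of `ui_of_crux` (stated through the removed TwoClocks copy of the crux). -/
@[deprecated ui_of_crux (since := "2026-08-17")]
alias collisionActivityUI_of_crux := ui_of_crux

/-- **Equilibrium FRACTION rung**: under the canonical Gibbs law with constant profiles the
window activity of a tagged sphere exceeds `V ≥ V₀` only on a vanishing expected fraction, as
`τ → ∞` after `N → ∞` (window `(0, w]`). -/
def EquilibriumActivityFraction : Prop :=
  ∀ (a₀ θ₀ : ℝ) (u₀ : V3), 0 < a₀ → 0 < θ₀ → ∃ σ₀ : ℝ, 0 < σ₀ ∧ ∀ σ : ℝ, 0 < σ → σ < σ₀ →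
    ∀ Φ : (N : ℕ) → Flow σ N, ∃ V₀ : ℝ, 0 < V₀ ∧ ∀ V : ℝ, V₀ ≤ V → ∀ ε : ℝ, 0 < ε →
    ∃ τ₀ : ℝ, 0 < τ₀ ∧ ∀ τ : ℝ, τ₀ ≤ τ → ∃ N₀ : ℕ, ∀ N : ℕ, N₀ ≤ N →
      ∫⁻ z, ENNReal.ofReal (activityFrac N V
          (fun i => activity (Φ N) τ (Set.Ioc 0 (window τ N)) i z))
        ∂(localGibbsLaw σ (fun _ => a₀) (fun _ => u₀) (fun _ => θ₀) N (Φ N)) ≤ ENNReal.ofReal ε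

/-- The landed equilibrium rung (`Negative/EquilibriumReduction.lean`, stated with the route's
inline `let`s) read through `activity` / `activityTail` / `window` (definitional unfolding only). -/
theorem equilibrium_iff_activityForm :
    CollisionActivityTailsEquilibrium.EquilibriumCollisionActivityTails ↔
    ∀ (a₀ θ₀ : ℝ) (u₀ : V3), 0 < a₀ → 0 < θ₀ → ∃ σ₀ : ℝ, 0 < σ₀ ∧ ∀ σ : ℝ, 0 < σ → σ < σ₀ →
      ∀ Φ : (N : ℕ) → Flow σ N, ∃ V₀ : ℝ, 0 < V₀ ∧ ∀ V : ℝ, V₀ ≤ V → ∀ ε : ℝ, 0 < ε →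
      ∃ τ₀ : ℝ, 0 < τ₀ ∧ ∀ τ : ℝ, τ₀ ≤ τ → ∃ N₀ : ℕ, ∀ N : ℕ, N₀ ≤ N →
        ∫⁻ z, ENNReal.ofReal (activityTail N V
            (fun i => activity (Φ N) τ (Set.Ioc 0 (window τ N)) i z))
          ∂(localGibbsLaw σ (fun _ => a₀) (fun _ => u₀) (fun _ => θ₀) N (Φ N)) ≤ ENNReal.ofReal ε :=
  Iff.rfl

/-- Equilibrium tails ⇒ equilibrium fraction (Chebyshev at the threshold). -/
theorem equilibriumActivityFraction_of_equilibrium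
    (h : CollisionActivityTailsEquilibrium.EquilibriumCollisionActivityTails) :
    EquilibriumActivityFraction := by
  rw [equilibrium_iff_activityForm] at h
  intro a₀ θ₀ u₀ ha hθ
  obtain ⟨σ₀, hσ₀, h⟩ := h a₀ θ₀ u₀ ha hθ
  refine ⟨σ₀, hσ₀, fun σ hσ hσσ₀ Φ => ?_⟩
  obtain ⟨V₀, hV₀, h⟩ := h σ hσ hσσ₀ Φ
  refine ⟨V₀, hV₀, fun V hV ε hε => ?_⟩
  have hVpos : 0 < V := hV₀.trans_le hV
  obtain ⟨τ₀, hτ₀, h⟩ := h V hV (V * ε) (mul_pos hVpos hε)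
  refine ⟨τ₀, hτ₀, fun τ hτ => ?_⟩
  obtain ⟨N₀, h⟩ := h τ hτ
  refine ⟨N₀, fun N hN => ?_⟩
  have key := (ofReal_mul_lintegral_activityFrac_le
    (localGibbsLaw σ (fun _ => a₀) (fun _ => u₀) (fun _ => θ₀) N (Φ N)) N hVpos.le
    fun z i => activity (Φ N) τ (Set.Ioc 0 (window τ N)) i z).trans (h N hN)
  rw [ENNReal.ofReal_mul hVpos.le] at key
  exact (ENNReal.mul_le_mul_iff_right (ENNReal.ofReal_pos.2 hVpos).ne' ENNReal.ofReal_ne_top).1 key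

/-- **Crux ⇒ equilibrium fraction rung** (unconditional: the landed equilibrium reduction
`CollisionActivityTailsEquilibrium.equilibrium_of_crux` + Chebyshev).
Contrapositive (`not_crux_of_not_equilibriumFraction`): persistent
hyperactivity of a tagged sphere at global equilibrium with non-vanishing PROBABILITY refutes the
crux. -/
theorem equilibriumFraction_of_crux
    (h : Summit.AtomisticToContinuum.HydrodynamicLimit.Theses.OneFlightGossipEngine.CollisionActivityTails) :
    EquilibriumActivityFraction :=
  equilibriumActivityFraction_of_equilibrium
    (CollisionActivityTailsEquilibrium.equilibrium_of_crux h)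

/-- Former name of `equilibriumFraction_of_crux` (stated through the removed TwoClocks copy of the
crux, via the former name `CollisionActivityTailsEquilibrium.equilibriumCollisionActivityTails_of_crux` of
the equilibrium reduction). -/
@[deprecated equilibriumFraction_of_crux (since := "2026-08-17")]
alias equilibriumActivityFraction_of_crux := equilibriumFraction_of_crux

/-- Any counterexample to the equilibrium fraction rung refutes the crux. -/
theorem not_crux_of_not_equilibriumFraction
    (h : ¬ EquilibriumActivityFraction) :
    ¬ Summit.AtomisticToContinuum.HydrodynamicLimit.Theses.OneFlightGossipEngine.CollisionActivityTails :=
  fun hc => h (equilibriumFraction_of_crux hc)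

/-- Former name of `not_crux_of_not_equilibriumFraction` (concluded the negation of the removed
TwoClocks copy of the crux). -/
@[deprecated not_crux_of_not_equilibriumFraction (since := "2026-08-17")]
alias not_collisionActivityTails_of_not_equilibriumActivityFraction := not_crux_of_not_equilibriumFraction

end CollisionActivityTailsFraction

end Summit.AtomisticToContinuum.HydrodynamicLimit.Theorems

end
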